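import Literature.Geometry.Riemannian.MeanConvexSweep
import HarnessLib

/-!
# Lawson–Michelsohn (1984), Thm. 3.1 (attaching thin handles of codimension `≥ 2` with positive
# mean curvature) as a named fact, and the discharge of Thm. 6.1 from it

Topic `Geometry/Riemannian`; namespace `Literature.Geometry.Riemannian`. The named fact
`Literature.Geometry.Riemannian.LawsonMichelsohn1984_surrounding` (`MeanConvexSurrounding.lean`;
H. B. Lawson, M.-L. Michelsohn, *Embedding and surrounding with positive mean curvature*, Invent.
Math. 77 (1984), Thm. (6.1) in `ℝ^{m+1}`, `m ≥ 4`: a `1`-thin compact domain is surrounded, through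
a strong isotopy of its boundary, by a hypersurface of positive mean curvature) has been reduced
in this directory to exactly ONE input, the paper's handle theorem:

* the topological half of the proof of (6.1) — "`D_f` is 1-thin […] by standard handlebody theory
  `D_f` has a handle decomposition all of whose handles have codimension `≥ 2`" — is PROVED
  (`exists_isMorseFunction_domain`, `MeanConvexSurroundingHandles.lean`: Milnor's cancellation
  Thm. 8.1 and Wall's trading theorem on the cobordism `(D; ∅, N)`);
* the sweep over the critical levels, the product structure above the core, the clock and the
  gradient-collar strong isotopy are PROVED (`MeanConvexSweep(Steps).lean`,
  `MeanConvexSurroundingReduction/Endgame/OuterBand.lean`);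
* `Literature.Geometry.Riemannian.LawsonMichelsohn1984_surrounding_of_thinHandles`
  (`MeanConvexSweep.lean`) PROVES "(3.1) ⇒ (6.1)" with (3.1) in the explicit Euclidean form `hG1`
  consumed by the sweep across one critical level (`sweep_crit`).

This file records that input as the named fact
`Literature.Geometry.Riemannian.LawsonMichelsohn1984_thinHandles` — VERBATIM the hypothesis `hG1`
— and PROVES the assembly `LawsonMichelsohn1984_surrounding_holds_of`.

**The statement (Thm. (3.1) of §3, iterated over the handles of one critical level, in Morse
charts).** (3.1) is the handle theorem (paraphrase, as in `MeanConvexHandleIsotopy.lean`): in a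
riemannian manifold with no restriction on the metric, attaching a sufficiently thin handle of
codimension `≥ 2` — a tube around an embedded disc `Dᵖ`, `p ≤ n - 2`, hanging on the boundary —
to a compact domain whose boundary has positive mean curvature with respect to the outer normal
yields, after smoothing, again a compact domain whose boundary has positive mean curvature.
Rendered in `ℝ^{m+1}` along a Morse function `f` at a critical level `c`: given finitely many Morse charts `e p` (`p ∈ P`, pairwise disjoint closed `R`-balls, in which
`f = c - (x₁² + ⋯ + x_λ²) + (x_{λ+1}² + ⋯)`, all indices `λ = lam p ≤ m - 1`, i.e. handles of
codimension `≥ 2`), a strictly mean-convex compact regular domain `{G ≤ 0} = {f ≤ c - ε}`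
(`2ε ≤ R²`) and an open set `U` containing the descending (core) discs
`{x_{λ+1} = ⋯ = 0, x₁² + ⋯ + x_λ² ≤ ε}`: there are re-chosen Morse charts `e' p` (same
normal form, same balls' disjointness) and a smooth `G'`, differing from `G` only inside `U`, with
`{f ≤ c - ε} ⊆ {G' ≤ 0}`, the core discs inside `{G' < 0}`, `{G' ≤ s}` compact for some `s > 0`,
`dG' ≠ 0` and strict mean convexity (`∑ᵢ D²G'(vᵢ,vᵢ) > 0` on orthonormal frames of `ker dG'`,
= `‖∇G'‖·H > 0`, §2 (2.4)–(2.6)) along `{G' = 0}`, together with the transversality certificate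
used by the sweep to push `{G' ≤ 0}` up to the next regular level along a gradient-like field
(outside the charts `df(v) > 0 ≤ dG'(v)` for some `v`; inside, a non-negative derivative of
`G' ∘ (e' p)⁻¹` along a positive combination of the Milnor model field and the radial field).
Mathlib has no mean curvature, tubes or handles, whence this calculus rendering (the same idiom
as the parent fact).

The child does not restate the parent: it is a LOCAL statement about one critical level of a
Morse function and a given mean-convex domain (no `1`-thin hypothesis, no embedded `N`, no strong
isotopy), the parent a global statement about `1`-thin domains.

## References

* H. B. Lawson, Jr., M.-L. Michelsohn, *Embedding and surrounding with positive mean curvature*,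
  Invent. Math. 77 (1984), 399–419: Thm. (3.1) (§3) and the proof of Thm. (6.1) (p. 416:
  "`D_f` can be built up from a small ball by attaching thin handles of index `≤ n - 2`, and
  Theorem 3.1 applies at each stage"). [LawsonMichelsohn1984]
* J. Milnor, *Morse theory* (1963), Lemma 2.2 (Morse charts), Thms. 3.1–3.2. [Milnor1963]
-/

noncomputable section

open scoped Manifold ContDiff Topology
open Set Function Filter Metric Literature.Topology.FourManifolds

namespace Literature.Geometry.Riemannian

/-- NAMED FACT — **Lawson–Michelsohn 1984, Thm. (3.1): thin handles of codimension `≥ 2` can be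
attached to a strictly mean-convex domain keeping strict mean convexity**, in the explicit
Euclidean form consumed by the mean-convex sweep (one critical level `c` of a Morse function `f`
on `ℝ^{m+1}`, `m ≥ 4`; Morse charts `e p`, `p ∈ P`, with indices `lam p ≤ m - 1`; the mean-convex
domain `{G ≤ 0} = {f ≤ c - ε}`; an open `U ⊇` the core discs; output: re-chosen charts `e'`, a
smooth `G'` equal to `G` off `U`, strictly mean convex and regular along `{G' = 0}`, swallowing the
core discs, with the transversality certificate) — see the module docstring for the reading of
each clause. (Thm. (3.1): thin handles of codimension `≥ 2` attach to a domain of positive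
boundary mean curvature keeping positive mean curvature, for any ambient metric; proof of (6.1),
p. 416: "`D_f` can be built up from a small ball by attaching thin handles of index `≤ n - 2`, and
Theorem 3.1 applies at each stage".) Verbatim the hypothesis `hG1` of
`LawsonMichelsohn1984_surrounding_of_thinHandles`.
Users take `(h : LawsonMichelsohn1984_thinHandles)`.
[cite: LawsonMichelsohn1984, Thm. (3.1) (§3) and proof of Thm. (6.1) (p. 416)] -/
def LawsonMichelsohn1984_thinHandles : Prop :=
  ∀ m : ℕ, 4 ≤ m →
  ∀ (f G : EuclideanSpace ℝ (Fin (m + 1)) → ℝ) (c ε R : ℝ) (P : Finset (EuclideanSpace ℝ (Fin (m + 1)))) (lam : EuclideanSpace ℝ (Fin (m + 1)) → ℕ)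
  (e : EuclideanSpace ℝ (Fin (m + 1)) → OpenPartialHomeomorph (EuclideanSpace ℝ (Fin (m + 1))) (EuclideanSpace ℝ (Fin (m + 1)))) (U : Set (EuclideanSpace ℝ (Fin (m + 1)))),
  ContDiff ℝ ∞ f → ContDiff ℝ ∞ G → 0 < ε → 0 < R → 2 * ε ≤ R ^ 2 →
  (∀ p ∈ P, lam p + 1 ≤ m) →
  (∀ p ∈ P, e p ∈ IsManifold.maximalAtlas (𝓡 (m + 1)) ∞ (EuclideanSpace ℝ (Fin (m + 1)))) →
  (∀ p ∈ P, p ∈ (e p).source ∧ e p p = 0) →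
  (∀ p ∈ P, Metric.closedBall (0 : EuclideanSpace ℝ (Fin (m + 1))) R ⊆ (e p).target) →
  (∀ p ∈ P, ∀ y ∈ (e p).target,
    f ((e p).symm y) = c - sqSumLT (lam p) y + sqSumGE (lam p) y) →
  (∀ p ∈ P, ∀ p' ∈ P, p ≠ p' → Disjoint ((e p).symm '' Metric.closedBall (0 : EuclideanSpace ℝ (Fin (m + 1))) R)
    ((e p').symm '' Metric.closedBall (0 : EuclideanSpace ℝ (Fin (m + 1))) R)) →
  IsCompact {x | f x ≤ c + ε} →
  {x | G x ≤ 0} = {x | f x ≤ c - ε} →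
  (∃ s, 0 < s ∧ IsCompact {x | G x ≤ s}) →
  (∀ x, f x = c - ε → fderiv ℝ f x ≠ 0) →
  (∀ x, G x = 0 → fderiv ℝ G x ≠ 0) →
  (∀ x, G x = 0 → ∀ v : Fin m → EuclideanSpace ℝ (Fin (m + 1)), Orthonormal ℝ v →
    (∀ i, fderiv ℝ G x (v i) = 0) → 0 < ∑ i, iteratedFDeriv ℝ 2 G x ![v i, v i]) →
  IsOpen U →
  (∀ p ∈ P, ∀ y : EuclideanSpace ℝ (Fin (m + 1)), (∀ i : Fin (m + 1), lam p ≤ i.val → y i = 0) →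
    sqSumLT (lam p) y ≤ ε → (e p).symm y ∈ U) →
  ∃ (e' : EuclideanSpace ℝ (Fin (m + 1)) → OpenPartialHomeomorph (EuclideanSpace ℝ (Fin (m + 1))) (EuclideanSpace ℝ (Fin (m + 1)))) (G' : EuclideanSpace ℝ (Fin (m + 1)) → ℝ),
    (∀ p ∈ P, e' p ∈ IsManifold.maximalAtlas (𝓡 (m + 1)) ∞ (EuclideanSpace ℝ (Fin (m + 1)))) ∧
    (∀ p ∈ P, p ∈ (e' p).source ∧ e' p p = 0) ∧
    (∀ p ∈ P, Metric.closedBall (0 : EuclideanSpace ℝ (Fin (m + 1))) R ⊆ (e' p).target) ∧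
    (∀ p ∈ P, ∀ y ∈ (e' p).target,
      f ((e' p).symm y) = c - sqSumLT (lam p) y + sqSumGE (lam p) y) ∧
    (∀ p ∈ P, ∀ p' ∈ P, p ≠ p' → Disjoint ((e' p).symm '' Metric.closedBall (0 : EuclideanSpace ℝ (Fin (m + 1))) R)
      ((e' p').symm '' Metric.closedBall (0 : EuclideanSpace ℝ (Fin (m + 1))) R)) ∧
    ContDiff ℝ ∞ G' ∧ {x | G' x ≠ G x} ⊆ U ∧
    (∀ x, f x ≤ c - ε → G' x ≤ 0) ∧
    (∀ p ∈ P, ∀ y : EuclideanSpace ℝ (Fin (m + 1)), (∀ i : Fin (m + 1), lam p ≤ i.val → y i = 0) →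
      sqSumLT (lam p) y ≤ ε → G' ((e' p).symm y) < 0) ∧
    (∃ s, 0 < s ∧ IsCompact {x | G' x ≤ s}) ∧
    (∀ x, G' x = 0 → fderiv ℝ G' x ≠ 0) ∧
    (∀ x, G' x = 0 → ∀ v : Fin m → EuclideanSpace ℝ (Fin (m + 1)), Orthonormal ℝ v →
      (∀ i, fderiv ℝ G' x (v i) = 0) → 0 < ∑ i, iteratedFDeriv ℝ 2 G' x ![v i, v i]) ∧
    (∃ δ, 0 < δ ∧ ∀ x, G' x ≤ 0 → c - ε - δ < f x →
      (x ∉ (⋃ p ∈ P, (e' p).symm '' Metric.closedBall (0 : EuclideanSpace ℝ (Fin (m + 1))) R) ∧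
        ∃ v, 0 < fderiv ℝ f x v ∧ 0 ≤ fderiv ℝ G' x v) ∨
      (∃ p ∈ P, ∃ y ∈ Metric.closedBall (0 : EuclideanSpace ℝ (Fin (m + 1))) R, x = (e' p).symm y ∧
        (y ≠ 0 → ∃ a b : ℝ, 0 ≤ a ∧ 0 ≤ b ∧
          0 < a * sqSumLT (lam p) y + (a + 2 * b) * sqSumGE (lam p) y ∧
          0 ≤ fderiv ℝ (G' ∘ (e' p).symm) y
            (a • milnorModelField (lam p) y + b • (y + milnorModelField (lam p) y)))))

/-- **Assembly (PROVED): Lawson–Michelsohn's Thm. (6.1) in `ℝ^{m+1}`, `m ≥ 4`, from Thm. (3.1).**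
`LawsonMichelsohn1984_surrounding` follows from `LawsonMichelsohn1984_thinHandles` by
`LawsonMichelsohn1984_surrounding_of_thinHandles` (the handle decomposition of the `1`-thin
domain, the sweep and the strong isotopy being proved in this directory).
[cite: LawsonMichelsohn1984, Thms. (3.1), (6.1)] -/
theorem LawsonMichelsohn1984_surrounding_holds_of (h : LawsonMichelsohn1984_thinHandles) :
    LawsonMichelsohn1984_surrounding :=
  LawsonMichelsohn1984_surrounding_of_thinHandles h

end Literature.Geometry.Riemannian

end
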